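import Mathlib
import HarnessLib
import Summits.HubbardSuperconductivity.HubbardSuperconductivity.Theses.ChiralWindow
import Summits.HubbardSuperconductivity.HubbardSuperconductivity.Theorems.ChiralWindowCwChiralConstructionKLWindowOfPoint
import Summits.HubbardSuperconductivity.HubbardSuperconductivity.Theorems.ChiralWindowCwChiralConstructionLevelWindowTransfer
import Summits.HubbardSuperconductivity.HubbardSuperconductivity.Theorems.ChiralWindowCwChiralConstructionFillingAtNegThreeTenths
import Summits.HubbardSuperconductivity.HubbardSuperconductivity.Theorems.ChiralWindowCwChiralConstructionOfKLMechanism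

/-!
# Crux `CwChiralConstruction` (stmt-HubbardSuperconductivity-1740) — the strategist's split glue

Route `HubbardSuperconductivity/ChiralWindow`, rank-2 crux ("the programme"). Crux-strategist seat
planner-cstrat-stmt-HubbardSuperconductivity-1740-s1-0 (gen 1), 2026-08-17.
Re-checked against the live tree (rc 0, 0 sorries, axioms propext/Classical.choice/Quot.sound), probed (both hypotheses:
`#h21_crux_probe` CLEAN; piece → summit, piece → crux and converses all fail) and proposed as the SPLIT GLUE by the redirect
strategist r1 (planner-cstrat-stmt-HubbardSuperconductivity-1740-r1-0), 2026-08-17.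

Kernel-checked implication for the typed split of the crux into the two propositions that, since lead
c5 (rev c5-3) of line `ladder-scale-transfer`, are the ONLY open registered stubs of BOTH weak-coupling
order cruxes of the summit (this crux and `WeakCouplingBCS.WcbcsBcsConstruction`, stmt-2010, whose skeleton
registers them byte-identically) and whose promotion to first-class items was asked for by leads
1740-c4…c8 and 2010-c3…c5 (`Cruxes/CwChiralConstruction/SHARED-CORE-R1B.md`,
`Cruxes/WcbcsBcsConstruction/LINE-STATUS.md` §Recommendation 1):

* (Kpt) **`B₁g` strictly leading at ONE window doping** — `∃ δ₀ ∈ [3/10, 12/25] ∃ γ U₁ > 0 ∀ U < U₁ ∀ χ ≠ B1g,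
  Λ_U(μ(1-δ₀), B1g) + γU² ≤ Λ_U(μ(1-δ₀), χ)` (the whole Kohn–Luttinger INPUT of the crux; certified
  numerics; closed modulo the one-point enclosure `stub_klPointEnclosure` by the landed p146657/p148296/p145573);
* (M) **the Kohn–Luttinger mechanism in local uniform form** — on every level window `[μ₁, μ₂] ⊂ [-2, -3/10]`
  where `B₁g` leads by `γU²` for `U < U₁`, an order floor `e^{-C/U²} ≤ dWaveOrderParameter U μ` on all
  operator levels `μ ∈ [μ₁ + U/2, μ₂]`, `U < U₀` (the open constructive problem, record-free).

`CwChiralConstruction_of_subs : (Kpt) → (M) → CwChiralConstruction` is the composition of LANDED theorems only: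
`stub_klLeadingMuWindowOfPoint` (p141740: point ⇒ level window with certified free fillings in `(13/25, 7/10)`),
`filling_neg_two_le_half'` and `stub_fillingAtNegThreeTenths` (p141417) to place that window inside `[-2, -3/10]`
(`monotone_filling`), and the record-free transfer `cwChiralConstruction_of_orderFloorOnCertifiedLevelWindow`
(p142268; generic-`μ` density frame `cw_genericDensity` inside). It is the body of `CwChiralConstruction_of` of
`Cruxes/CwChiralConstruction/Lines/ladder_scale_transfer.lean` rev c7-2 with the two stubs abstracted as hypotheses,
stated with the children's statements VERBATIM so that `ledger route edit --split CwChiralConstruction --glue-by` can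
cite it. Neither hypothesis is the crux reworded: (Kpt) is a statement about the free band and the second-order
kernel only; (M) is uniform on level windows under an explicit KL-leading hypothesis and fixes no doping, while the
crux fixes no window and asks one `μ` per `U` (neither implies the other; together they imply the crux).
-/

set_option linter.dupNamespace false

namespace Summit.HubbardSuperconductivity.HubbardSuperconductivity.Theorems

open Literature.MathematicalPhysics.QuantumLattice Filter
open Summit.HubbardSuperconductivity.HubbardSuperconductivity.Theses.ChiralWindow
open scoped Topology

/-- **Split glue of crux `CwChiralConstruction` (strategist, gen 1).** (Kpt) `B₁g` strictly leading with margin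
`γU²` at one window doping `δ₀ ∈ [3/10, 12/25]` for all small `U`, and (M) the Kohn–Luttinger mechanism in local
uniform form (γU²-leading on a level window `⊂ [-2, -3/10]` ⇒ floor `e^{-C/U²}` on `[μ₁ + U/2, μ₂]` for all small
`U`), together imply `CwChiralConstruction`. Composition of landed theorems (p141740, p141417, p142268,
`filling_neg_two_le_half'`). [cite: KohnLuttinger1965] [cite: RaghuKivelsonScalapino2010, §II (7), (13)]
[cite: KomaTasaki1994, §1] -/
theorem CwChiralConstruction_of_subs : (∃ δ₀ ∈ Set.Icc (3/10 : ℝ) (12/25), ∃ γ U₁ : ℝ, 0 < γ ∧ 0 < U₁ ∧ ∀ U ∈ Set.Ioo (0:ℝ) U₁, ∀ χ : D4Irrep, χ ≠ D4Irrep.B1g → channelInf (squareDispersion 1 0) (chemicalPotentialOfDensity (squareDispersion 1 0) (1 - δ₀)) U D4Irrep.B1g + γ * U ^ 2 ≤ channelInf (squareDispersion 1 0) (chemicalPotentialOfDensity (squareDispersion 1 0) (1 - δ₀)) U χ) → (∀ μ₁ μ₂ γ U₁ : ℝ, -2 ≤ μ₁ → μ₁ < μ₂ → μ₂ ≤ -(3:ℝ)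 / 10 → 0 < γ → 0 < U₁ → (∀ U ∈ Set.Ioo (0:ℝ) U₁, ∀ μ ∈ Set.Icc μ₁ μ₂, ∀ χ : D4Irrep, χ ≠ D4Irrep.B1g → channelInf (squareDispersion 1 0) μ U D4Irrep.B1g + γ * U ^ 2 ≤ channelInf (squareDispersion 1 0) μ U χ) → ∃ U₀ C : ℝ, 0 < U₀ ∧ 0 < C ∧ ∀ U ∈ Set.Ioo (0:ℝ) U₀, ∀ μ ∈ Set.Icc (μ₁ + U / 2) μ₂, Real.exp (-C / U ^ 2) ≤ dWaveOrderParameter U μ) → CwChiralConstruction := by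
  intro hKpt hM
  obtain ⟨μ₁, μ₂, γ, U₁, _h4, h12, _h0, hγ, hU₁, hn₁, hn₂, hK⟩ := stub_klLeadingMuWindowOfPoint hKpt
  -- `n(μ₁) > 13/25 > 1/2 ≥ n(-2)` forces `-2 ≤ μ₁`
  have hμ₁ : -2 ≤ μ₁ := by
    by_contra hlt
    have hlt : μ₁ < -2 := not_le.mp hlt
    have := monotone_filling hlt.le
    linarith [filling_neg_two_le_half']
  -- `n(μ₂) < 7/10 ≤ n(-3/10)` forces `μ₂ ≤ -3/10`
  have hμ₂ : μ₂ ≤ -(3:ℝ) / 10 := by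
    by_contra hlt
    have hlt : -(3:ℝ) / 10 < μ₂ := not_le.mp hlt
    have := monotone_filling hlt.le
    linarith [stub_fillingAtNegThreeTenths]
  exact cwChiralConstruction_of_orderFloorOnCertifiedLevelWindow h12 hn₁ hn₂
    (hM μ₁ μ₂ γ U₁ hμ₁ h12 hμ₂ hγ hU₁ hK)

end Summit.HubbardSuperconductivity.HubbardSuperconductivity.Theorems
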